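import Summits.QuantumFields.GaugeBoot.StrongCouplingCubicSUN
import Summits.QuantumFields.GaugeBoot.StrongCouplingPlaquetteSU3ThirdPieces
import HarnessLib

/-!
# Strong coupling from the loop equation: the level-2 right sides of the `SU(N)` plaquette are `O(β²)` for `N ≥ 4` (gauge-boot, ADDENDUM 25 part D)

HONEST FRAMING (cell `pub-gaugeboot`, page 1 of every file): the venture produces certified bounds
on lattice expectations at stated coupling, gauge group, dimension and torus size; NOT a mass gap,
NOT a continuum limit, NOT a string tension; NOT Yang–Mills-summit-bearing (barriers
`FixedCouplingUltralocality`, `PerturbativeInvisibility`).  Crude explicit bounds on a finite torus `(ℤ/L)^d`,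
`L ≥ 2`, every real (tree) coupling `β = β_std/N`; no number of the cell's tables is certified here.

## Content

The three level-2 identities of ADDENDUM 22 (`(N − 2/N)b + a = −(β/2)r₂`, `(N − 2/N)a + b = −(β/2)r₁`,
`N(m − 1) = −(β/2)r₃`; `a = E[(tr U_P)²]`, `b = E[tr U_P²]`, `m = E|tr U_P|²`) have right sides
`r₂ = ΣΣE[plaqTerm(P̃₀P̃₀)]`, `r₁ = ΣΣE[plaqTerm(P̃₀)·tr U_P]`, `r₃ = ΣΣE[plaqTerm(P̃₀)·tr U_P⁻¹]`.  Every constituent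
of these sums is a level-3 quantity: for the `2d − 3` plaquettes `q ≠ P̃₀` a read-once bound (`StrongCouplingReadOnce`),
for `q = P̃₀` a cubic moment of the plaquette (`StrongCouplingCubicSUN`).  For `SU(N)`, `N ≥ 4`:

* `norm_integral_plaqTerm_mul_trace_suN_le₁` — `‖E[plaqTerm_{ν,ε}(P̃₀)·tr hol v]‖ ≤ 16(d−1)N³|β|/(N²−1)`
  (`v ∈ {P̃₀, P̃₀⁻¹}`, `(ν,ε) ≠ (ν₀,+)`; `N ≥ 2`); `norm_integral_plaqTerm_double_suN_le₁` —
  `‖E[plaqTerm_{ν,ε}(P̃₀P̃₀)]‖ ≤ 16(d−1)N²|β|/(N²−1)` (`N ≥ 2`);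
* the diagonal terms through the cubic moments: `‖E[plaqTerm_{ν₀,+}(P̃₀)·t]‖ ≤ 75N(d−1)|β|`,
  `‖E[plaqTerm_{ν₀,+}(P̃₀)·t']‖ ≤ 36N(d−1)|β|`, `‖E[plaqTerm_{ν₀,+}(P̃₀P̃₀)]‖ ≤ 32N²(d−1)|β|`;
* ★★ the sums: **`‖r₁‖ ≤ (36d + 21)N(d−1)|β|`, `‖r₃‖ ≤ (36d − 18)N(d−1)|β|`, `‖r₂‖ ≤ (32N² + 36d − 54)(d−1)|β|`** —
  so `a, b, m − 1 = O(β²)` (`StrongCouplingPlaquetteSUNThird`).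

References: Yu. Makeenko, *Methods of contemporary gauge theory* (2002) Problem 12.7; M. Creutz, *Quarks, gluons and
lattices* (1983) Ch. 8.  Everything is `[folklore]`.
-/

noncomputable section

open MeasureTheory Filter Topology NormedSpace
open scoped Matrix.Norms.Frobenius Matrix ComplexConjugate
open Literature.MathematicalPhysics.QuantumFieldTheory Literature.MathematicalPhysics.QuantumLattice
open Summit.QuantumFields.YangMills.Cruxes.CurvatureAmnesia.WardDefect.SchwingerDyson

namespace Summit.QuantumFields.GaugeBoot

namespace StrongCoupling

variable {d L N : ℕ} [NeZero L]

/-! ## Rounding of the one-step constants for `N ≥ 4` -/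

omit [NeZero L] in
/-- `4(d−1)N²|β|/(N²−1) ≤ 5(d−1)|β|` for `N ≥ 4`. [folklore] -/
theorem oneStep_le_five (hN : 4 ≤ N) (hd1 : (0 : ℝ) ≤ (d : ℝ) - 1) (β : ℝ) :
    4 * ((d : ℝ) - 1) * (N : ℝ) ^ 2 * |β| / ((N : ℝ) ^ 2 - 1) ≤ 5 * (((d : ℝ) - 1) * |β|) := by
  have hN4 : (4 : ℝ) ≤ N := by exact_mod_cast hN
  have hN21 : (0 : ℝ) < (N : ℝ) ^ 2 - 1 := by nlinarith
  rw [div_le_iff₀ hN21]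
  have h0 : 0 ≤ ((d : ℝ) - 1) * |β| := by positivity
  have h15 : (0 : ℝ) ≤ (N : ℝ) ^ 2 - 5 := by nlinarith
  nlinarith [mul_nonneg h0 h15]

omit [NeZero L] in
/-- `16(d−1)N²X/(N²−1) ≤ 18(d−1)X` for `N ≥ 4`, `X ≥ 0`. [folklore] -/
theorem sixteen_le_eighteen (hN : 4 ≤ N) {X : ℝ} (hX : 0 ≤ X) :
    16 * (N : ℝ) ^ 2 * X / ((N : ℝ) ^ 2 - 1) ≤ 18 * X := by
  have hN4 : (4 : ℝ) ≤ N := by exact_mod_cast hN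
  have hN21 : (0 : ℝ) < (N : ℝ) ^ 2 - 1 := by nlinarith
  rw [div_le_iff₀ hN21]
  have h9 : (0 : ℝ) ≤ (N : ℝ) ^ 2 - 9 := by nlinarith
  nlinarith [mul_nonneg hX h9]

/-! ## The off-diagonal terms (read-once) -/

/-- ★ For `(ν, ε) ≠ (ν₀, +)`, `ν ≠ μ` (`SU(N)`, `N ≥ 2`): `‖E[plaqTerm_{ν,ε}(P̃₀)·tr hol v]‖ ≤ 16(d−1)N³|β|/(N²−1)` for
`v ∈ {P̃₀, P̃₀⁻¹}` — each of its four pieces is a read-once bound at a private link of `q = plaqWord μ ν ε` with a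
multiplier. [folklore] -/
theorem norm_integral_plaqTerm_mul_trace_suN_le₁ (hN : 2 ≤ N) (hL : (1 : ZMod L) ≠ 0) (β : ℝ) (x : Site d L)
    {μ ν₀ ν : Fin d} (hμν₀ : μ ≠ ν₀) (hνμ : ν ≠ μ) {ε : Bool} (hne : ¬(ν = ν₀ ∧ ε = true)) {v : Word d}
    (hv : v = plaqWord μ ν₀ true ∨ v = (plaqWord μ ν₀ true).reverse) :
    ‖∫ U, plaqTerm (fundamentalRep (Fin N)) 1 x μ U (plaqWord μ ν₀ true) ν ε *
        (fundamentalRep (Fin N) (wordHolonomy U x v)).trace ∂(wilsonMeasure (d := d) (L := L) (fundamentalRep (Fin N)) β)‖ ≤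
      16 * ((d : ℝ) - 1) * (N : ℝ) ^ 3 * |β| / ((N : ℝ) ^ 2 - 1) := by
  have hv' : qEdge x μ ν ε ∉ Word.edgesRead x v := by
    rcases hv with rfl | rfl
    · exact (qEdge_not_mem_plaqWordZero hL x hμν₀ hνμ hne).1
    · exact (qEdge_not_mem_plaqWordZero hL x hμν₀ hνμ hne).2.1
  have hP : qEdge x μ ν ε ∉ Word.edgesRead x (plaqWord μ ν₀ true) := (qEdge_not_mem_plaqWordZero hL x hμν₀ hνμ hne).1
  have gP := mulData_trace (N := N) x (plaqWord μ ν₀ true) hP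
  have gv := mulData_trace (N := N) x v hv'
  rw [integral_plaqTerm_mul_trace_suN]
  have hsw : ∀ (w : Word d) (U : GaugeConfig d L (Matrix.specialUnitaryGroup (Fin N) ℂ)),
      (fundamentalRep (Fin N) (wordHolonomy U x (plaqWord μ ν₀ true))).trace *
          (fundamentalRep (Fin N) (wordHolonomy U x w)).trace * (fundamentalRep (Fin N) (wordHolonomy U x v)).trace =
        (fundamentalRep (Fin N) (wordHolonomy U x w)).trace *
          ((fundamentalRep (Fin N) (wordHolonomy U x (plaqWord μ ν₀ true))).trace *
            (fundamentalRep (Fin N) (wordHolonomy U x v)).trace) := fun w U => by ring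
  simp_rw [hsw]
  have h1 := norm_integral_trace_plaqWord_append_qw_mul_le (d := d) (L := L) hN hL β x hμν₀ hνμ hne (Or.inl rfl) gv
  have h2 := norm_integral_trace_plaqWord_append_qw_mul_le (d := d) (L := L) hN hL β x hμν₀ hνμ hne (Or.inr rfl) gv
  have h3 := norm_integral_trace_qw_mul_le (d := d) (L := L) hN hL β x hνμ ε (Or.inl rfl) (mulData_mul gP gv)
  have h4 := norm_integral_trace_qw_mul_le (d := d) (L := L) hN hL β x hνμ ε (Or.inr rfl) (mulData_mul gP gv)
  refine (norm_four_piece_le h1 h2 h3 h4).trans (le_of_eq ?_)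
  have hN2 : (2 : ℝ) ≤ N := by exact_mod_cast hN
  have hNpos : (0 : ℝ) < N := by linarith
  field_simp
  ring

/-- `P̃₀P̃₀ · w` reads `qEdge` exactly once (`w ∈ {q, q⁻¹}`). [folklore] -/
theorem count_qEdge_double_append (hL : (1 : ZMod L) ≠ 0) (x : Site d L) {μ ν₀ ν : Fin d} (hμν₀ : μ ≠ ν₀)
    (hνμ : ν ≠ μ) {ε : Bool} (hne : ¬(ν = ν₀ ∧ ε = true)) {w : Word d}
    (hw : w = plaqWord μ ν ε ∨ w = (plaqWord μ ν ε).reverse) :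
    (Word.edgesRead x ((plaqWord μ ν₀ true ++ plaqWord μ ν₀ true) ++ w)).count (qEdge x μ ν ε) = 1 := by
  have hPP : Word.endpoint x (plaqWord μ ν₀ true ++ plaqWord μ ν₀ true) = x := by
    rw [Word.endpoint_append, endpoint_plaqWord, endpoint_plaqWord]
  rw [Word.edgesRead_append, hPP, List.count_append, Word.edgesRead_append, endpoint_plaqWord, List.count_append,
    List.count_eq_zero_of_not_mem (qEdge_not_mem_plaqWordZero hL x hμν₀ hνμ hne).1, count_qEdge_eq_one hL x hνμ ε hw]

omit [NeZero L] in
/-- `qEdge` is not read by `P̃₀P̃₀`. [folklore] -/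
theorem qEdge_not_mem_double [NeZero L] (hL : (1 : ZMod L) ≠ 0) (x : Site d L) {μ ν₀ ν : Fin d} (hμν₀ : μ ≠ ν₀) (hνμ : ν ≠ μ)
    {ε : Bool} (hne : ¬(ν = ν₀ ∧ ε = true)) :
    qEdge x μ ν ε ∉ Word.edgesRead x (plaqWord μ ν₀ true ++ plaqWord μ ν₀ true) := by
  rw [Word.edgesRead_append, endpoint_plaqWord]
  exact List.not_mem_append (qEdge_not_mem_plaqWordZero hL x hμν₀ hνμ hne).1 (qEdge_not_mem_plaqWordZero hL x hμν₀ hνμ hne).1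

/-- ★ For `(ν, ε) ≠ (ν₀, +)`, `ν ≠ μ` (`SU(N)`, `N ≥ 2`): the plaquette terms of the DOUBLY-WOUND plaquette are `O(β)`,
`‖E[plaqTerm_{ν,ε}(P̃₀P̃₀)]‖ ≤ 16(d−1)N²|β|/(N²−1)` — `P̃₀P̃₀q^{±1}` reads the private link of `q` once, and
`tr hol(P̃₀P̃₀)` is a multiplier for `q^{±1}`. [folklore] -/
theorem norm_integral_plaqTerm_double_suN_le₁ (hN : 2 ≤ N) (hL : (1 : ZMod L) ≠ 0) (β : ℝ) (x : Site d L)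
    {μ ν₀ ν : Fin d} (hμν₀ : μ ≠ ν₀) (hνμ : ν ≠ μ) {ε : Bool} (hne : ¬(ν = ν₀ ∧ ε = true)) :
    ‖∫ U, plaqTerm (fundamentalRep (Fin N)) 1 x μ U (plaqWord μ ν₀ true ++ plaqWord μ ν₀ true) ν ε
        ∂(wilsonMeasure (d := d) (L := L) (fundamentalRep (Fin N)) β)‖ ≤ 16 * ((d : ℝ) - 1) * (N : ℝ) ^ 2 * |β| / ((N : ℝ) ^ 2 - 1) := by
  have hPP : Word.endpoint x (plaqWord μ ν₀ true ++ plaqWord μ ν₀ true) = x := by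
    rw [Word.endpoint_append, endpoint_plaqWord, endpoint_plaqWord]
  have h := integral_plaqTerm_latticeRep (d := d) (L := L) (fundamentalLatticeRep N) β 1 x μ
    (plaqWord μ ν₀ true ++ plaqWord μ ν₀ true) ν ε
  simp only [fundamentalLatticeRep_N, fundamentalLatticeRep_ρ] at h
  have h' : ∫ U, plaqTerm (fundamentalRep (Fin N)) 1 x μ U (plaqWord μ ν₀ true ++ plaqWord μ ν₀ true) ν ε
      ∂(wilsonMeasure (d := d) (L := L) (fundamentalRep (Fin N)) β) =
      (∫ U, (fundamentalRep (Fin N) (wordHolonomy U x ((plaqWord μ ν₀ true ++ plaqWord μ ν₀ true) ++ plaqWord μ ν ε))).trace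
          ∂(wilsonMeasure (d := d) (L := L) (fundamentalRep (Fin N)) β)) -
        (∫ U, (fundamentalRep (Fin N) (wordHolonomy U x ((plaqWord μ ν₀ true ++ plaqWord μ ν₀ true) ++
            (plaqWord μ ν ε).reverse))).trace ∂(wilsonMeasure (d := d) (L := L) (fundamentalRep (Fin N)) β)) -
        1 / (N : ℂ) * ((∫ U, (fundamentalRep (Fin N) (wordHolonomy U x (plaqWord μ ν₀ true ++ plaqWord μ ν₀ true))).trace *
            (fundamentalRep (Fin N) (wordHolonomy U x (plaqWord μ ν ε))).trace
              ∂(wilsonMeasure (d := d) (L := L) (fundamentalRep (Fin N)) β)) -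
          (∫ U, (fundamentalRep (Fin N) (wordHolonomy U x (plaqWord μ ν₀ true ++ plaqWord μ ν₀ true))).trace *
            (fundamentalRep (Fin N) (wordHolonomy U x (plaqWord μ ν ε).reverse)).trace
              ∂(wilsonMeasure (d := d) (L := L) (fundamentalRep (Fin N)) β))) := h
  rw [h']
  have gD := mulData_trace (N := N) x (plaqWord μ ν₀ true ++ plaqWord μ ν₀ true) (qEdge_not_mem_double hL x hμν₀ hνμ hne)
  have key : ∀ {w : Word d} (hw : w = plaqWord μ ν ε ∨ w = (plaqWord μ ν ε).reverse),
      ‖∫ U, (fundamentalRep (Fin N) (wordHolonomy U x ((plaqWord μ ν₀ true ++ plaqWord μ ν₀ true) ++ w))).trace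
          ∂(wilsonMeasure (d := d) (L := L) (fundamentalRep (Fin N)) β)‖ ≤
        4 * ((d : ℝ) - 1) * (N : ℝ) ^ 2 * |β| / ((N : ℝ) ^ 2 - 1) := fun hw => by
    have h1 := readOnce_suN hN β x _ (by rw [Word.endpoint_append, hPP, endpoint_qw x ε hw]) _
      (count_qEdge_double_append hL x hμν₀ hνμ hne hw) (mulData_one (e := qEdge x μ ν ε))
    simp only [mul_one] at h1
    exact h1
  have hsw : ∀ (w : Word d) (U : GaugeConfig d L (Matrix.specialUnitaryGroup (Fin N) ℂ)),
      (fundamentalRep (Fin N) (wordHolonomy U x (plaqWord μ ν₀ true ++ plaqWord μ ν₀ true))).trace *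
          (fundamentalRep (Fin N) (wordHolonomy U x w)).trace =
        (fundamentalRep (Fin N) (wordHolonomy U x w)).trace *
          (fundamentalRep (Fin N) (wordHolonomy U x (plaqWord μ ν₀ true ++ plaqWord μ ν₀ true))).trace := fun w U => mul_comm _ _
  simp_rw [hsw]
  have h3 := norm_integral_trace_qw_mul_le (d := d) (L := L) hN hL β x hνμ ε (Or.inl rfl) gD
  have h4 := norm_integral_trace_qw_mul_le (d := d) (L := L) hN hL β x hνμ ε (Or.inr rfl) gD
  refine (norm_four_piece_le (key (Or.inl rfl)) (key (Or.inr rfl)) h3 h4).trans (le_of_eq ?_)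
  have hN2 : (2 : ℝ) ≤ N := by exact_mod_cast hN
  have hNpos : (0 : ℝ) < N := by linarith
  field_simp
  ring

omit [NeZero L] in
/-- The four-piece bound with four different bounds: `‖A − B − (1/N)(C − D)‖ ≤ a + b + (1/N)(c + e)`. [folklore] -/
theorem norm_four_piece_le' {A B C D : ℂ} {a b c e : ℝ} {N : ℕ} (hA : ‖A‖ ≤ a) (hB : ‖B‖ ≤ b) (hC : ‖C‖ ≤ c)
    (hD : ‖D‖ ≤ e) : ‖A - B - 1 / (N : ℂ) * (C - D)‖ ≤ a + b + 1 / N * (c + e) := by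
  have hNinv : ‖(1 / (N : ℂ))‖ = 1 / N := by rw [norm_div, norm_one, Complex.norm_natCast]
  refine (norm_sub_le _ _).trans (add_le_add ((norm_sub_le _ _).trans (add_le_add hA hB)) ?_)
  rw [norm_mul, hNinv]
  exact mul_le_mul_of_nonneg_left ((norm_sub_le _ _).trans (add_le_add hC hD)) (by positivity)

/-! ## The diagonal terms through the cubic moments (`N ≥ 4`) -/

omit [NeZero L] in
/-- `tr hol(P̃₀ · P̃₀⁻¹) = N`. [folklore] -/
theorem trace_plaqWord_append_reverse_suN (U : GaugeConfig d L (Matrix.specialUnitaryGroup (Fin N) ℂ)) (x : Site d L)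
    (μ ν₀ : Fin d) :
    (fundamentalRep (Fin N) (wordHolonomy U x (plaqWord μ ν₀ true ++ (plaqWord μ ν₀ true).reverse))).trace = N := by
  rw [wordHolonomy_append_reverse, map_one, Matrix.trace_one, Fintype.card_fin]

omit [NeZero L] in
/-- `hol(P̃₀P̃₀ · P̃₀⁻¹) = hol P̃₀`. [folklore] -/
theorem wordHolonomy_double_append_reverse {G : Type} [Group G] (U : GaugeConfig d L G) (x : Site d L) (μ ν₀ : Fin d) :
    wordHolonomy U x ((plaqWord μ ν₀ true ++ plaqWord μ ν₀ true) ++ (plaqWord μ ν₀ true).reverse) =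
      wordHolonomy U x (plaqWord μ ν₀ true) := by
  rw [List.append_assoc, wordHolonomy_append_closed U x _ _ (endpoint_plaqWord x μ ν₀ true), wordHolonomy_append_reverse,
    mul_one]

omit [NeZero L] in
/-- `ρ(hol(P̃₀P̃₀ · P̃₀)) = ρ(hol(P̃₀P̃₀))·ρ(hol P̃₀)`. [folklore] -/
theorem rho_wordHolonomy_triple {G : Type} [Group G] {ρ : G →* Matrix (Fin N) (Fin N) ℂ} (U : GaugeConfig d L G)
    (x : Site d L) (μ ν₀ : Fin d) :
    ρ (wordHolonomy U x ((plaqWord μ ν₀ true ++ plaqWord μ ν₀ true) ++ plaqWord μ ν₀ true)) =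
      ρ (wordHolonomy U x (plaqWord μ ν₀ true ++ plaqWord μ ν₀ true)) * ρ (wordHolonomy U x (plaqWord μ ν₀ true)) := by
  rw [wordHolonomy_append_closed U x _ _ (by rw [Word.endpoint_append, endpoint_plaqWord, endpoint_plaqWord]), map_mul]

/-- ★ **The self-deformation term with spectator `t = tr U_P`** (`SU(N)`, `N ≥ 4`): `‖E[plaqTerm_{ν₀,+}(P̃₀)·t]‖ ≤ 75N(d−1)|β|`
(`= E[D t] − N E[t] − (1/N)(E[t³] − E[t t t'])`, all cubic moments `O(β)`). [folklore] -/
theorem norm_integral_plaqTermZero_mul_trace_suN_le (hN : 4 ≤ N) (hL : (1 : ZMod L) ≠ 0) (β : ℝ) (x : Site d L)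
    {μ ν₀ : Fin d} (hμν₀ : μ ≠ ν₀) :
    ‖∫ U, plaqTerm (fundamentalRep (Fin N)) 1 x μ U (plaqWord μ ν₀ true) ν₀ true *
        (fundamentalRep (Fin N) (wordHolonomy U x (plaqWord μ ν₀ true))).trace
          ∂(wilsonMeasure (d := d) (L := L) (fundamentalRep (Fin N)) β)‖ ≤ 75 * (N : ℝ) * ((d : ℝ) - 1) * |β| := by
  have hN2 : 2 ≤ N := by omega
  have hN4 : (4 : ℝ) ≤ N := by exact_mod_cast hN
  have hNpos : (0 : ℝ) < N := by linarith
  have hd1 : (0 : ℝ) ≤ (d : ℝ) - 1 := sub_one_nonneg_of_axis μ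
  set t : GaugeConfig d L (Matrix.specialUnitaryGroup (Fin N) ℂ) → ℂ :=
    fun U => (fundamentalRep (Fin N) (wordHolonomy U x (plaqWord μ ν₀ true))).trace with ht
  set t' : GaugeConfig d L (Matrix.specialUnitaryGroup (Fin N) ℂ) → ℂ :=
    fun U => (fundamentalRep (Fin N) (wordHolonomy U x (plaqWord μ ν₀ true).reverse)).trace with ht'
  rw [integral_plaqTerm_mul_trace_suN]
  simp_rw [trace_plaqWord_append_reverse_suN]
  have hNt : ∫ U, (N : ℂ) * t U ∂(wilsonMeasure (d := d) (L := L) (fundamentalRep (Fin N)) β) =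
      N * ∫ U, t U ∂(wilsonMeasure (d := d) (L := L) (fundamentalRep (Fin N)) β) := integral_const_mul _ _
  have hsw : ∫ U, t U * t' U * t U ∂(wilsonMeasure (d := d) (L := L) (fundamentalRep (Fin N)) β) =
      ∫ U, t U * t U * t' U ∂(wilsonMeasure (d := d) (L := L) (fundamentalRep (Fin N)) β) :=
    integral_congr_ae (ae_of_all _ fun U => by ring)
  rw [hNt, hsw]
  obtain ⟨hκ, hη, -⟩ := cubicMoments_suN_le (d := d) (L := L) hN hL β x hμν₀
  have hA := norm_integral_trace_sq_mul_reverse_suN_le (d := d) (L := L) hN2 hL β x hμν₀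
  have hτ := (norm_integral_trace_plaqWord_suN_le (d := d) (L := L) hN2 hL β x hμν₀).trans (oneStep_le_five hN hd1 β)
  have hB : ‖(N : ℂ) * ∫ U, t U ∂(wilsonMeasure (d := d) (L := L) (fundamentalRep (Fin N)) β)‖ ≤ N * (5 * (((d : ℝ) - 1) * |β|)) := by
    rw [norm_mul, Complex.norm_natCast]; exact mul_le_mul_of_nonneg_left hτ hNpos.le
  refine (norm_four_piece_le' hη hB hκ hA).trans (le_of_eq ?_)
  field_simp
  ring

/-- ★ **The self-deformation term with spectator `t' = tr U_P⁻¹`** (`SU(N)`, `N ≥ 4`): `‖E[plaqTerm_{ν₀,+}(P̃₀)·t']‖ ≤ 36N(d−1)|β|`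
(`= E[D t'] − N E[t'] − (1/N)(E[t t t'] − E[t t' t'])`). [folklore] -/
theorem norm_integral_plaqTermZero_mul_trace_reverse_suN_le (hN : 4 ≤ N) (hL : (1 : ZMod L) ≠ 0) (β : ℝ) (x : Site d L)
    {μ ν₀ : Fin d} (hμν₀ : μ ≠ ν₀) :
    ‖∫ U, plaqTerm (fundamentalRep (Fin N)) 1 x μ U (plaqWord μ ν₀ true) ν₀ true *
        (fundamentalRep (Fin N) (wordHolonomy U x (plaqWord μ ν₀ true).reverse)).trace
          ∂(wilsonMeasure (d := d) (L := L) (fundamentalRep (Fin N)) β)‖ ≤ 36 * (N : ℝ) * ((d : ℝ) - 1) * |β| := by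
  have hN2 : 2 ≤ N := by omega
  have hN4 : (4 : ℝ) ≤ N := by exact_mod_cast hN
  have hNpos : (0 : ℝ) < N := by linarith
  have hd1 : (0 : ℝ) ≤ (d : ℝ) - 1 := sub_one_nonneg_of_axis μ
  set t' : GaugeConfig d L (Matrix.specialUnitaryGroup (Fin N) ℂ) → ℂ :=
    fun U => (fundamentalRep (Fin N) (wordHolonomy U x (plaqWord μ ν₀ true).reverse)).trace with ht'
  rw [integral_plaqTerm_mul_trace_suN]
  simp_rw [trace_plaqWord_append_reverse_suN]
  have hNt : ∫ U, (N : ℂ) * t' U ∂(wilsonMeasure (d := d) (L := L) (fundamentalRep (Fin N)) β) =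
      N * ∫ U, t' U ∂(wilsonMeasure (d := d) (L := L) (fundamentalRep (Fin N)) β) := integral_const_mul _ _
  rw [hNt]
  have hC := norm_integral_trace_double_mul_reverse_suN_le (d := d) (L := L) hN2 hL β x hμν₀
  have hA := norm_integral_trace_sq_mul_reverse_suN_le (d := d) (L := L) hN2 hL β x hμν₀
  have hA' := norm_integral_trace_mul_reverse_sq_suN_le (d := d) (L := L) hN2 hL β x hμν₀
  have hτ := (norm_integral_trace_plaqWord_reverse_suN_le (d := d) (L := L) hN2 hL β x hμν₀).trans (oneStep_le_five hN hd1 β)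
  have hB : ‖(N : ℂ) * ∫ U, t' U ∂(wilsonMeasure (d := d) (L := L) (fundamentalRep (Fin N)) β)‖ ≤ N * (5 * (((d : ℝ) - 1) * |β|)) := by
    rw [norm_mul, Complex.norm_natCast]; exact mul_le_mul_of_nonneg_left hτ hNpos.le
  refine (norm_four_piece_le' hC hB hA hA').trans (le_of_eq ?_)
  field_simp
  ring

/-- ★ **The self-deformation term of the doubly-wound plaquette** (`SU(N)`, `N ≥ 4`):
`‖E[plaqTerm_{ν₀,+}(P̃₀P̃₀)]‖ ≤ 32N²(d−1)|β|` (`= E[tr U_P³] − E[t] − (1/N)(E[D t] − E[D t'])`). [folklore] -/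
theorem norm_integral_plaqTermZero_double_suN_le (hN : 4 ≤ N) (hL : (1 : ZMod L) ≠ 0) (β : ℝ) (x : Site d L)
    {μ ν₀ : Fin d} (hμν₀ : μ ≠ ν₀) :
    ‖∫ U, plaqTerm (fundamentalRep (Fin N)) 1 x μ U (plaqWord μ ν₀ true ++ plaqWord μ ν₀ true) ν₀ true
        ∂(wilsonMeasure (d := d) (L := L) (fundamentalRep (Fin N)) β)‖ ≤ 32 * (N : ℝ) ^ 2 * ((d : ℝ) - 1) * |β| := by
  have hN2 : 2 ≤ N := by omega
  have hN4 : (4 : ℝ) ≤ N := by exact_mod_cast hN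
  have hNpos : (0 : ℝ) < N := by linarith
  have hd1 : (0 : ℝ) ≤ (d : ℝ) - 1 := sub_one_nonneg_of_axis μ
  have h := integral_plaqTerm_latticeRep (d := d) (L := L) (fundamentalLatticeRep N) β 1 x μ
    (plaqWord μ ν₀ true ++ plaqWord μ ν₀ true) ν₀ true
  simp only [fundamentalLatticeRep_N, fundamentalLatticeRep_ρ] at h
  have h' : ∫ U, plaqTerm (fundamentalRep (Fin N)) 1 x μ U (plaqWord μ ν₀ true ++ plaqWord μ ν₀ true) ν₀ true
      ∂(wilsonMeasure (d := d) (L := L) (fundamentalRep (Fin N)) β) =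
      (∫ U, (fundamentalRep (Fin N) (wordHolonomy U x ((plaqWord μ ν₀ true ++ plaqWord μ ν₀ true) ++ plaqWord μ ν₀ true))).trace
          ∂(wilsonMeasure (d := d) (L := L) (fundamentalRep (Fin N)) β)) -
        (∫ U, (fundamentalRep (Fin N) (wordHolonomy U x ((plaqWord μ ν₀ true ++ plaqWord μ ν₀ true) ++
            (plaqWord μ ν₀ true).reverse))).trace ∂(wilsonMeasure (d := d) (L := L) (fundamentalRep (Fin N)) β)) -
        1 / (N : ℂ) * ((∫ U, (fundamentalRep (Fin N) (wordHolonomy U x (plaqWord μ ν₀ true ++ plaqWord μ ν₀ true))).trace *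
            (fundamentalRep (Fin N) (wordHolonomy U x (plaqWord μ ν₀ true))).trace
              ∂(wilsonMeasure (d := d) (L := L) (fundamentalRep (Fin N)) β)) -
          (∫ U, (fundamentalRep (Fin N) (wordHolonomy U x (plaqWord μ ν₀ true ++ plaqWord μ ν₀ true))).trace *
            (fundamentalRep (Fin N) (wordHolonomy U x (plaqWord μ ν₀ true).reverse)).trace
              ∂(wilsonMeasure (d := d) (L := L) (fundamentalRep (Fin N)) β))) := h
  rw [h']
  simp_rw [rho_wordHolonomy_triple, wordHolonomy_double_append_reverse]
  obtain ⟨-, hη, hθ⟩ := cubicMoments_suN_le (d := d) (L := L) hN hL β x hμν₀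
  have hC := norm_integral_trace_double_mul_reverse_suN_le (d := d) (L := L) hN2 hL β x hμν₀
  have hτ := (norm_integral_trace_plaqWord_suN_le (d := d) (L := L) hN2 hL β x hμν₀).trans (oneStep_le_five hN hd1 β)
  refine (norm_four_piece_le' hθ hτ hη hC).trans ?_
  have e : 1 / (N : ℝ) * (49 * (N : ℝ) * ((d : ℝ) - 1) * |β| + 17 * (N : ℝ) * ((d : ℝ) - 1) * |β|) =
      66 * (((d : ℝ) - 1) * |β|) := by field_simp; ring
  rw [e]
  have hY : 0 ≤ ((d : ℝ) - 1) * |β| := by positivity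
  have h16 : (0 : ℝ) ≤ (N : ℝ) ^ 2 - 16 := by nlinarith
  nlinarith [mul_nonneg hY h16]

/-! ## The three sums -/

/-- ★★ **`r₁ = O(β)`**: `‖ΣΣ E[plaqTerm_{ν,ε}(P̃₀)·tr U_P]‖ ≤ (36d + 21)N(d−1)|β|` (`SU(N)`, `N ≥ 4`). [folklore] -/
theorem norm_selfSpectatorSum_suN_le (hN : 4 ≤ N) (hL : (1 : ZMod L) ≠ 0) (β : ℝ) (x : Site d L) {μ ν₀ : Fin d}
    (hμν₀ : μ ≠ ν₀) :
    ‖∑ ν ∈ Finset.univ.erase μ, ∑ ε : Bool, ∫ U, plaqTerm (fundamentalRep (Fin N)) 1 x μ U (plaqWord μ ν₀ true) ν ε *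
        (fundamentalRep (Fin N) (wordHolonomy U x (plaqWord μ ν₀ true))).trace
          ∂(wilsonMeasure (d := d) (L := L) (fundamentalRep (Fin N)) β)‖ ≤
      (36 * (d : ℝ) + 21) * N * ((d : ℝ) - 1) * |β| := by
  have hN2 : 2 ≤ N := by omega
  have hN4 : (4 : ℝ) ≤ N := by exact_mod_cast hN
  have hNpos : (0 : ℝ) < N := by linarith
  have hd1 : (0 : ℝ) ≤ (d : ℝ) - 1 := sub_one_nonneg_of_axis μ
  have hν₀ : ν₀ ∈ Finset.univ.erase μ := Finset.mem_erase.2 ⟨fun h => hμν₀ h.symm, Finset.mem_univ _⟩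
  rw [sum_sum_eq_add hν₀]
  have h0 := norm_integral_plaqTermZero_mul_trace_suN_le (d := d) (L := L) hN hL β x hμν₀
  have hB : 16 * ((d : ℝ) - 1) * (N : ℝ) ^ 3 * |β| / ((N : ℝ) ^ 2 - 1) ≤ 18 * (N * (((d : ℝ) - 1) * |β|)) := by
    have h := sixteen_le_eighteen hN (X := N * (((d : ℝ) - 1) * |β|)) (by positivity)
    refine (le_of_eq ?_).trans h
    ring
  have hoff := norm_offDiagonal_le hμν₀ (fun ν ε => ∫ U, plaqTerm (fundamentalRep (Fin N)) 1 x μ U (plaqWord μ ν₀ true) ν ε *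
      (fundamentalRep (Fin N) (wordHolonomy U x (plaqWord μ ν₀ true))).trace ∂(wilsonMeasure (d := d) (L := L) (fundamentalRep (Fin N)) β))
    (B := 18 * (N * (((d : ℝ) - 1) * |β|)))
    (fun ν hν => by
      obtain ⟨hνν₀, hν'⟩ := Finset.mem_erase.1 hν
      exact (norm_integral_plaqTerm_mul_trace_suN_le₁ hN2 hL β x hμν₀ (Finset.mem_erase.1 hν').1 (fun h => hνν₀ h.1)
        (Or.inl rfl)).trans hB)
    (fun ν hν => (norm_integral_plaqTerm_mul_trace_suN_le₁ hN2 hL β x hμν₀ (Finset.mem_erase.1 hν).1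
        (fun h => Bool.false_ne_true h.2) (Or.inl rfl)).trans hB)
  refine (norm_add_le _ _).trans ((add_le_add h0 hoff).trans (le_of_eq ?_))
  ring

/-- ★★ **`r₃ = O(β)`**: `‖ΣΣ E[plaqTerm_{ν,ε}(P̃₀)·tr U_P⁻¹]‖ ≤ (36d − 18)N(d−1)|β|` (`SU(N)`, `N ≥ 4`). [folklore] -/
theorem norm_reverseSpectatorSum_suN_le (hN : 4 ≤ N) (hL : (1 : ZMod L) ≠ 0) (β : ℝ) (x : Site d L) {μ ν₀ : Fin d}
    (hμν₀ : μ ≠ ν₀) :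
    ‖∑ ν ∈ Finset.univ.erase μ, ∑ ε : Bool, ∫ U, plaqTerm (fundamentalRep (Fin N)) 1 x μ U (plaqWord μ ν₀ true) ν ε *
        (fundamentalRep (Fin N) (wordHolonomy U x (plaqWord μ ν₀ true).reverse)).trace
          ∂(wilsonMeasure (d := d) (L := L) (fundamentalRep (Fin N)) β)‖ ≤
      (36 * (d : ℝ) - 18) * N * ((d : ℝ) - 1) * |β| := by
  have hN2 : 2 ≤ N := by omega
  have hN4 : (4 : ℝ) ≤ N := by exact_mod_cast hN
  have hNpos : (0 : ℝ) < N := by linarith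
  have hd1 : (0 : ℝ) ≤ (d : ℝ) - 1 := sub_one_nonneg_of_axis μ
  have hν₀ : ν₀ ∈ Finset.univ.erase μ := Finset.mem_erase.2 ⟨fun h => hμν₀ h.symm, Finset.mem_univ _⟩
  rw [sum_sum_eq_add hν₀]
  have h0 := norm_integral_plaqTermZero_mul_trace_reverse_suN_le (d := d) (L := L) hN hL β x hμν₀
  have hB : 16 * ((d : ℝ) - 1) * (N : ℝ) ^ 3 * |β| / ((N : ℝ) ^ 2 - 1) ≤ 18 * (N * (((d : ℝ) - 1) * |β|)) := by
    have h := sixteen_le_eighteen hN (X := N * (((d : ℝ) - 1) * |β|)) (by positivity)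
    refine (le_of_eq ?_).trans h
    ring
  have hoff := norm_offDiagonal_le hμν₀ (fun ν ε => ∫ U, plaqTerm (fundamentalRep (Fin N)) 1 x μ U (plaqWord μ ν₀ true) ν ε *
      (fundamentalRep (Fin N) (wordHolonomy U x (plaqWord μ ν₀ true).reverse)).trace
        ∂(wilsonMeasure (d := d) (L := L) (fundamentalRep (Fin N)) β))
    (B := 18 * (N * (((d : ℝ) - 1) * |β|)))
    (fun ν hν => by
      obtain ⟨hνν₀, hν'⟩ := Finset.mem_erase.1 hν
      exact (norm_integral_plaqTerm_mul_trace_suN_le₁ hN2 hL β x hμν₀ (Finset.mem_erase.1 hν').1 (fun h => hνν₀ h.1)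
        (Or.inr rfl)).trans hB)
    (fun ν hν => (norm_integral_plaqTerm_mul_trace_suN_le₁ hN2 hL β x hμν₀ (Finset.mem_erase.1 hν).1
        (fun h => Bool.false_ne_true h.2) (Or.inr rfl)).trans hB)
  refine (norm_add_le _ _).trans ((add_le_add h0 hoff).trans (le_of_eq ?_))
  ring

/-- ★★ **`r₂ = O(β)`**: `‖ΣΣ E[plaqTerm_{ν,ε}(P̃₀P̃₀)]‖ ≤ (32N² + 36d − 54)(d−1)|β|` (`SU(N)`, `N ≥ 4`). [folklore] -/
theorem norm_doubleSum_suN_le (hN : 4 ≤ N) (hL : (1 : ZMod L) ≠ 0) (β : ℝ) (x : Site d L) {μ ν₀ : Fin d} (hμν₀ : μ ≠ ν₀) :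
    ‖∑ ν ∈ Finset.univ.erase μ, ∑ ε : Bool, ∫ U, plaqTerm (fundamentalRep (Fin N)) 1 x μ U
        (plaqWord μ ν₀ true ++ plaqWord μ ν₀ true) ν ε ∂(wilsonMeasure (d := d) (L := L) (fundamentalRep (Fin N)) β)‖ ≤
      (32 * (N : ℝ) ^ 2 + 36 * (d : ℝ) - 54) * ((d : ℝ) - 1) * |β| := by
  have hN2 : 2 ≤ N := by omega
  have hd1 : (0 : ℝ) ≤ (d : ℝ) - 1 := sub_one_nonneg_of_axis μ
  have hν₀ : ν₀ ∈ Finset.univ.erase μ := Finset.mem_erase.2 ⟨fun h => hμν₀ h.symm, Finset.mem_univ _⟩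
  rw [sum_sum_eq_add hν₀]
  have h0 := norm_integral_plaqTermZero_double_suN_le (d := d) (L := L) hN hL β x hμν₀
  have hB : 16 * ((d : ℝ) - 1) * (N : ℝ) ^ 2 * |β| / ((N : ℝ) ^ 2 - 1) ≤ 18 * (((d : ℝ) - 1) * |β|) := by
    have h := sixteen_le_eighteen hN (X := ((d : ℝ) - 1) * |β|) (by positivity)
    refine (le_of_eq ?_).trans h
    ring
  have hoff := norm_offDiagonal_le hμν₀ (fun ν ε => ∫ U, plaqTerm (fundamentalRep (Fin N)) 1 x μ U
      (plaqWord μ ν₀ true ++ plaqWord μ ν₀ true) ν ε ∂(wilsonMeasure (d := d) (L := L) (fundamentalRep (Fin N)) β))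
    (B := 18 * (((d : ℝ) - 1) * |β|))
    (fun ν hν => by
      obtain ⟨hνν₀, hν'⟩ := Finset.mem_erase.1 hν
      exact (norm_integral_plaqTerm_double_suN_le₁ hN2 hL β x hμν₀ (Finset.mem_erase.1 hν').1 (fun h => hνν₀ h.1)).trans hB)
    (fun ν hν => (norm_integral_plaqTerm_double_suN_le₁ hN2 hL β x hμν₀ (Finset.mem_erase.1 hν).1
        (fun h => Bool.false_ne_true h.2)).trans hB)
  refine (norm_add_le _ _).trans ((add_le_add h0 hoff).trans (le_of_eq ?_))
  ring

end StrongCoupling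

end Summit.QuantumFields.GaugeBoot

end
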